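import Literature.Analysis.FluidPDE.ForcedFourierForceData
import Literature.Analysis.FluidPDE.NSRegFourierFamily
import HarnessLib

/-!
# The time-derivative tower of the Fourier-side force of a Schwartz-on-slab forcing term
# (physical transfer for the forced Fourier–Picard construction of Tao 2013, Thm. 5.4, part 2)

Analysis/FluidPDE proof file (cell `pub/ns-blowup`, seat `ns-blowup-lit` g10; second file of the
«PHYSICAL TRANSFER OF THE FORCE» for the forced twin of the tree's Fourier-side local existence
engine; bears_on the Literature leaf `tao2011_smooth_local_existence_forced` /
`tao2011_forced_H1_local_almost_regular`; WHAT THIS IS NOT: not a statement about Navier–Stokes —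
calculus bookkeeping of a forcing term). ONE plumbing definition (`FourierNS.forceDataFamily`, a
`def` with a body, no `Prop`) and theorems; no named facts.

`ForcedFourierForceData.lean` turns a force `f : ℝ → ℝ^ι → ℝ^ι` which is Schwartz on the closed
slab `[0, T] × ℝ^ι` (`IsSmoothSpaceTimeOn (Icc 0 T) f`, `HasUniformRapidDecayOn (Icc 0 T) f`) into
its Fourier-side force `b = forceData` (`b t ξ l = 𝓕⁻((f (clamp T t))ₗ^ℂ)(ξ)`). The classical half
of the engine (`ForcedFourierMildFamily.lean`, `IsSobolevMildForced.exists_family` /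
`IsSobolevMildForced.classical`) consumes in addition a DERIVATIVE TOWER of the force: a sequence
`B : ℕ → (ℝ → ℝ^ι → ι → ℂ)` with `B 0 = b` whose components are Fourier families of every order on
`[0, T]` in the tree's sense (`FourierNS.IsFourierFamily`: measurable slices, uniform `HasDecay` of
every order, continuity in time, and `∂ₜ B_k = B_{k+1}` as `HasDerivWithinAt … (Icc 0 T) t`). This
file supplies it, as Tao's proof does ("if the data are Schwartz then … `∂ₜʲ u, ∂ₜʲ p ∈ L^∞_t H^k`
for all `j, k`" — the time derivatives of the force are again Schwartz on the slab and the Fourier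
transform in `x` commutes with `∂ₜ`):

* §1 **time derivatives stay Schwartz on the slab**: `∂ₜ f = timeDerivWithin (Icc 0 T) f` and all
  its iterates are again jointly smooth with uniform rapid decay on `[0, T] × ℝ^ι`
  (`HasUniformRapidDecayOn.timeDerivWithin`, `.iterate_timeDerivWithin`: the joint derivatives of
  `∂ₜ f = D(uncurry f)(·)(1, 0)` are those of `uncurry f` one order up);
* §2 **the Fourier transform commutes with `∂ₜ`** on the closed slab: for `t₀ = 0 ≤ s ≤ T`,
  `b s ξ l − b 0 ξ l = ∫₀ˢ b′ σ ξ l dσ` with `b′ = forceData (∂ₜ f)` (fundamental theorem of calculus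
  in `t` under the Fourier integral, Fubini with the dominating function `C (1 + ‖x‖)^{-(d+1)}`),
  hence `HasDerivWithinAt (b · ξ l) (b′ t ξ l) (Icc 0 T) t` for every `t ∈ [0, T]`
  (`FourierNS.hasDerivWithinAt_forceData`);
* §3 **the tower** `forceDataFamily k = forceData ((timeDerivWithin (Icc 0 T))^[k] f)`:
  `forceDataFamily 0 = forceData`, every component is an `IsFourierFamily T n` (all `n`), hence an
  `IsDomFamily T n`; conjugation symmetry, synthesis `synthVel (B k t) = (∂ₜᵏ f) t` on `[0, T]`,
  joint continuity of every member, and the packaged existential `FourierNS.exists_forceData_tower`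
  in the binder shape of `IsSobolevMildForced.exists_family` / `.classical`.

The Leray projection of the tower and the force-pressure gauge are NOT in this file (seats
`ns-blowup-lit2` / `ns-blowup-lit3`, `FourierNS.lerayPart`).

## Mathlib / tree search

Tree (`lean search`): `FourierNS.forceData` and its API (`ForcedFourierForceData`),
`FourierNS.IsFourierFamily` (`NSFourierFamily`), `IsFourierFamily.isDomFamily` (`NSRegFourierFamily`),
`IsSmoothSpaceTimeOn.timeDerivWithin` / `.hasDerivWithinAt_timeDerivWithin` / `.timeDerivWithin_eq` /
`.contDiffOn_fderivWithin` (`ClassicalSolutionCalculus`), `HasUniformRapidDecayOn`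
(`TaoForcedUniquenessSchwartzForce`). `lean search 'forceDataFamily|hasDerivWithinAt_forceData'`: no
hits before this file. Mathlib: `intervalIntegral.integral_eq_sub_of_hasDeriv_right_of_le`,
`MeasureTheory.integral_integral_swap`, `Continuous.integral_hasStrictDerivAt`,
`ContinuousLinearMap.norm_iteratedFDerivWithin_comp_left`, `norm_iteratedFDerivWithin_fderivWithin`.

## References

* T. Tao, *Localisation and compactness properties of the Navier–Stokes global regularity
  problem*, Anal. PDE 6 (2013) = arXiv:1108.1165, Def. 1.1 (p. 3: Schwartz data `(u₀, f, T)`),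
  §5 proof of Thm. 5.4 (arXiv Thm. 31, p. 18) and the note closing it (time derivatives of all
  orders). [`Tao2011`]
* E. M. Stein, G. Weiss, *Introduction to Fourier Analysis on Euclidean Spaces*, PUP 1971, Ch. I,
  Thm. 1.8 / Thm. 2.3. [`SteinWeiss1971`]
-/

noncomputable section

open MeasureTheory Real Set Filter Function Complex FourierTransform
open scoped FourierTransform RealInnerProductSpace ContDiff ComplexConjugate NNReal
open _root_.Topology

namespace Literature.Analysis.FluidPDE

/-! ### §1 Time derivatives of a Schwartz-on-slab field -/

section TimeDerivDecay

variable {X : Type*} [NormedAddCommGroup X] [NormedSpace ℝ X]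
  {F : Type*} [NormedAddCommGroup F] [NormedSpace ℝ F]
  {S : Set ℝ} {w : ℝ → X → F}

/-- **Uniform rapid decay is inherited by the time derivative**: if `w` is jointly smooth on
`S × X` (`S` of unique differentiability) with `(1 + ‖x‖)^K ‖Dⁿ(uncurry w)(t, x)‖ ≤ C_{n,K}`, then
so is `∂ₜw = timeDerivWithin S w`, with the constants `C_{n+1,K}` (the joint derivatives of
`∂ₜw = D(uncurry w)(·)(1, 0)` are those of `uncurry w` one order up, evaluated in one slot at the
unit vector `(1, 0)`). [cite: Tao2011, Def. 1.1 (p. 3)] -/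
theorem HasUniformRapidDecayOn.timeDerivWithin (hd : HasUniformRapidDecayOn S w)
    (h : IsSmoothSpaceTimeOn S w) (hS : UniqueDiffOn ℝ S) :
    HasUniformRapidDecayOn S (FluidPDE.timeDerivWithin S w) := by
  intro n K
  obtain ⟨C, hC⟩ := hd (n + 1) K
  refine ⟨C, fun t ht x => ?_⟩
  have hD : UniqueDiffOn ℝ (S ×ˢ (univ : Set X)) := hS.prod uniqueDiffOn_univ
  have hz : (t, x) ∈ S ×ˢ (univ : Set X) := mk_mem_prod ht (mem_univ x)
  set L : (ℝ × X →L[ℝ] F) →L[ℝ] F := ContinuousLinearMap.apply ℝ F ((1 : ℝ), (0 : X)) with hL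
  have heq : EqOn (uncurry (FluidPDE.timeDerivWithin S w))
      (L ∘ fderivWithin ℝ (uncurry w) (S ×ˢ univ)) (S ×ˢ univ) := by
    rintro ⟨s, y⟩ hsy
    simp only [uncurry, Function.comp_apply, hL, ContinuousLinearMap.apply_apply]
    exact h.timeDerivWithin_eq hS hsy.1 y
  rw [iteratedFDerivWithin_congr heq hz n]
  have hfd : ContDiffWithinAt ℝ ∞ (fderivWithin ℝ (uncurry w) (S ×ˢ univ)) (S ×ˢ univ) (t, x) :=
    (h.contDiffOn_fderivWithin hS) _ hz
  have h1 := L.norm_iteratedFDerivWithin_comp_left hfd hD hz (n := n) (by exact_mod_cast le_top)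
  have hLn : ‖L‖ ≤ 1 := by
    refine ContinuousLinearMap.opNorm_le_bound _ zero_le_one fun φ => ?_
    rw [hL, ContinuousLinearMap.apply_apply, one_mul]
    refine (φ.le_opNorm _).trans ?_
    have : ‖((1 : ℝ), (0 : X))‖ ≤ 1 := by simp [Prod.norm_def]
    calc ‖φ‖ * ‖((1 : ℝ), (0 : X))‖ ≤ ‖φ‖ * 1 := by gcongr
      _ = ‖φ‖ := mul_one _
  have h2 := norm_iteratedFDerivWithin_fderivWithin (𝕜 := ℝ) (f := uncurry w) (n := n) hD hz
  calc (1 + ‖x‖) ^ K * ‖iteratedFDerivWithin ℝ n (L ∘ fderivWithin ℝ (uncurry w) (S ×ˢ univ))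
          (S ×ˢ univ) (t, x)‖
      ≤ (1 + ‖x‖) ^ K * (‖L‖ * ‖iteratedFDerivWithin ℝ n (fderivWithin ℝ (uncurry w) (S ×ˢ univ))
          (S ×ˢ univ) (t, x)‖) := mul_le_mul_of_nonneg_left h1 (by positivity)
    _ ≤ (1 + ‖x‖) ^ K * (1 * ‖iteratedFDerivWithin ℝ n (fderivWithin ℝ (uncurry w) (S ×ˢ univ))
          (S ×ˢ univ) (t, x)‖) := by gcongr
    _ = (1 + ‖x‖) ^ K * ‖iteratedFDerivWithin ℝ (n + 1) (uncurry w) (S ×ˢ univ) (t, x)‖ := by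
        rw [one_mul, h2]
    _ ≤ C := hC t ht x

/-- **All iterated time derivatives `(timeDerivWithin S)^[j] w` of a field jointly smooth with
uniform rapid decay on `S × X` are jointly smooth with uniform rapid decay** (induction on `j`).
[cite: Tao2011, Def. 1.1 (p. 3)] -/
theorem HasUniformRapidDecayOn.iterate_timeDerivWithin (hd : HasUniformRapidDecayOn S w)
    (h : IsSmoothSpaceTimeOn S w) (hS : UniqueDiffOn ℝ S) (j : ℕ) :
    IsSmoothSpaceTimeOn S ((FluidPDE.timeDerivWithin S)^[j] w) ∧
      HasUniformRapidDecayOn S ((FluidPDE.timeDerivWithin S)^[j] w) := by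
  induction j with
  | zero => exact ⟨h, hd⟩
  | succ j ih =>
      rw [Function.iterate_succ_apply']
      exact ⟨ih.1.timeDerivWithin hS, ih.2.timeDerivWithin ih.1 hS⟩

end TimeDerivDecay

namespace FourierNS

/-! ### §2 The Fourier transform in `x` commutes with `∂ₜ` on the closed slab -/

section TimeDeriv

variable {ι : Type*} [Fintype ι]
variable {T : ℝ} {f : ℝ → EuclideanSpace ℝ ι → EuclideanSpace ℝ ι}
variable (hT : 0 < T) (hf : IsSmoothSpaceTimeOn (Icc 0 T) f) (hd : HasUniformRapidDecayOn (Icc 0 T) f)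

include hT hf in
/-- Continuity in time of the complexified clamped coefficient `σ ↦ (f (clamp T σ) x)ₗ^ℂ`.
[cite: Tao2011, Thm. 5.4 proof (arXiv Thm. 31, p. 18)] -/
theorem continuous_coef_clamp_time (x : EuclideanSpace ℝ ι) (l : ι) :
    Continuous fun σ : ℝ => ((f (clamp T σ) x l : ℝ) : ℂ) := by
  have hc := continuous_force_clamp_uncurry hT hf
  have hg : Continuous fun σ : ℝ => ((σ, x) : ℝ × EuclideanSpace ℝ ι) :=
    continuous_id.prodMk continuous_const
  have h1 : Continuous fun σ : ℝ => f (clamp T σ) x :=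
    Continuous.comp (f := fun σ : ℝ => ((σ, x) : ℝ × EuclideanSpace ℝ ι))
      (g := fun p : ℝ × EuclideanSpace ℝ ι => f (clamp T p.1) p.2) hc hg
  exact Complex.continuous_ofReal.comp ((continuous_apply l).comp
    ((PiLp.continuous_ofLp 2 _).comp h1))

include hT hf in
/-- Joint continuity of the Fourier integrand `(σ, x) ↦ e^{2πi⟨x, ξ⟩} (f (clamp T σ) x)ₗ^ℂ`.
[cite: Tao2011, Thm. 5.4 proof (arXiv Thm. 31, p. 18)] -/
theorem continuous_fourierIntegrand_clamp (ξ : EuclideanSpace ℝ ι) (l : ι) :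
    Continuous fun p : ℝ × EuclideanSpace ℝ ι => 𝐞 ⟪p.2, ξ⟫ • ((f (clamp T p.1) p.2 l : ℝ) : ℂ) := by
  have hc := continuous_force_clamp_uncurry hT hf
  have h1 : Continuous fun p : ℝ × EuclideanSpace ℝ ι => ((f (clamp T p.1) p.2 l : ℝ) : ℂ) :=
    Complex.continuous_ofReal.comp ((continuous_apply l).comp ((PiLp.continuous_ofLp 2 _).comp hc))
  exact (continuous_fourierChar.comp (continuous_snd.inner continuous_const)).smul h1

include hT hf hd in
/-- The uniform polynomial bound of the complexified clamped coefficients: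
`‖(f (clamp T σ) x)ₗ^ℂ‖ ≤ C (1 + ‖x‖)^{-K}` for all `σ` and `x`, `K = d + 1`.
[cite: Tao2011, Def. 1.1 (p. 3)] -/
theorem exists_norm_coef_clamp_le (l : ι) :
    ∃ C : ℝ, 0 ≤ C ∧ ∀ (σ : ℝ) (x : EuclideanSpace ℝ ι), ‖((f (clamp T σ) x l : ℝ) : ℂ)‖ ≤
      C * (1 + ‖x‖) ^ (-((Module.finrank ℝ (EuclideanSpace ℝ ι) + 1 : ℕ) : ℝ)) := by
  obtain ⟨C, hC0, hC⟩ := hd.exists_uniform_slice_bound hf hT 0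
    (Module.finrank ℝ (EuclideanSpace ℝ ι) + 1)
  refine ⟨C, hC0, fun σ x => ?_⟩
  have h1 := hC _ (clamp_mem_Icc hT.le σ) x
  rw [norm_iteratedFDeriv_zero] at h1
  have h2 : ‖f (clamp T σ) x l‖ ≤ ‖f (clamp T σ) x‖ := PiLp.norm_apply_le _ l
  rw [Complex.norm_real]
  exact le_mul_rpow_neg_of_pow_mul_le ((mul_le_mul_of_nonneg_left h2 (by positivity)).trans h1)

include hT hf hd in
/-- Integrability of the Fourier integrand of a clamped slice. [cite: SteinWeiss1971, Ch. I Thm. 1.8] -/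
theorem integrable_fourierIntegrand_clamp (σ : ℝ) (ξ : EuclideanSpace ℝ ι) (l : ι) :
    Integrable fun x : EuclideanSpace ℝ ι => 𝐞 ⟪x, ξ⟫ • ((f (clamp T σ) x l : ℝ) : ℂ) := by
  obtain ⟨C, -, hC⟩ := exists_norm_coef_clamp_le hT hf hd l
  have hKr : (Module.finrank ℝ (EuclideanSpace ℝ ι) : ℝ) <
      ((Module.finrank ℝ (EuclideanSpace ℝ ι) + 1 : ℕ) : ℝ) := by push_cast; linarith
  refine Integrable.mono' ((integrable_one_add_norm hKr).const_mul C) ?_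
    (ae_of_all _ fun x => by rw [Circle.norm_smul]; exact hC σ x)
  exact ((continuous_fourierIntegrand_clamp hT hf ξ l).comp
    (Continuous.prodMk_right σ)).aestronglyMeasurable

/-- **The Fourier transform in `x` commutes with `∂ₜ` (integrated form).** For a Schwartz-on-slab
force `f`, its slab time derivative `∂ₜf = timeDerivWithin (Icc 0 T) f` and `s ∈ [0, T]`:
`∫₀ˢ forceData(∂ₜf) σ ξ l dσ = forceData f s ξ l − forceData f 0 ξ l` (fundamental theorem of
calculus in `t` at each `x`, then Fubini under the Fourier integral with the dominating function
`C (1 + ‖x‖)^{-(d+1)}`). [cite: Tao2011, Thm. 5.4 proof (arXiv Thm. 31, p. 18)] -/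
theorem integral_forceData_timeDerivWithin {s : ℝ} (hs : s ∈ Icc 0 T) (ξ : EuclideanSpace ℝ ι)
    (l : ι) :
    ∫ σ in (0 : ℝ)..s, forceData hT (hf.timeDerivWithin (uniqueDiffOn_Icc hT))
        (hd.timeDerivWithin hf (uniqueDiffOn_Icc hT)) σ ξ l =
      forceData hT hf hd s ξ l - forceData hT hf hd 0 ξ l := by
  have hU : UniqueDiffOn ℝ (Icc (0 : ℝ) T) := uniqueDiffOn_Icc hT
  have hg : IsSmoothSpaceTimeOn (Icc 0 T) (timeDerivWithin (Icc 0 T) f) := hf.timeDerivWithin hU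
  have hgd : HasUniformRapidDecayOn (Icc 0 T) (timeDerivWithin (Icc 0 T) f) :=
    hd.timeDerivWithin hf hU
  have hs0 : (0 : ℝ) ≤ s := hs.1
  -- the two Fourier integrands
  set Φ : ℝ → EuclideanSpace ℝ ι → ℂ := fun σ x => ((f (clamp T σ) x l : ℝ) : ℂ) with hΦ
  set Ψ : ℝ → EuclideanSpace ℝ ι → ℂ :=
    fun σ x => ((timeDerivWithin (Icc 0 T) f (clamp T σ) x l : ℝ) : ℂ) with hΨ
  have hb : ∀ σ, forceData hT hf hd σ ξ l = ∫ x, 𝐞 ⟪x, ξ⟫ • Φ σ x := fun σ => by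
    rw [forceData_apply, Real.fourierInv_eq]
  have hb' : ∀ σ, forceData hT hg hgd σ ξ l = ∫ x, 𝐞 ⟪x, ξ⟫ • Ψ σ x := fun σ => by
    rw [forceData_apply, Real.fourierInv_eq]
  -- (i) the fundamental theorem of calculus in `t` at each `x`
  have hFTC : ∀ x, ∫ σ in (0 : ℝ)..s, Ψ σ x = Φ s x - Φ 0 x := by
    intro x
    refine intervalIntegral.integral_eq_sub_of_hasDeriv_right_of_le hs0
      (continuous_coef_clamp_time hT hf x l).continuousOn (fun σ hσ => ?_)
      ((continuous_coef_clamp_time hT hg x l).intervalIntegrable _ _)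
    have hσT : σ ∈ Icc (0 : ℝ) T := ⟨hσ.1.le, hσ.2.le.trans hs.2⟩
    set L : EuclideanSpace ℝ ι →L[ℝ] ℂ := Complex.ofRealCLM.comp (EuclideanSpace.proj l) with hL
    have hLa : ∀ v : EuclideanSpace ℝ ι, L v = ((v l : ℝ) : ℂ) := fun v => rfl
    have h1 := hf.hasDerivWithinAt_timeDerivWithin hU hσT x
    have h2 := L.hasFDerivAt.comp_hasDerivWithinAt σ h1
    have h3 : HasDerivWithinAt (fun r => Φ r x) (Ψ σ x) (Icc 0 T) σ := by
      refine (h2.congr_of_mem (fun r hr => ?_) hσT).congr_deriv ?_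
      · simp only [hΦ, Function.comp_apply, hLa, clamp_of_mem hr]
      · simp only [hΨ, hLa, clamp_of_mem hσT]
    exact h3.mono_of_mem_nhdsWithin
      (mem_nhdsWithin_of_mem_nhds (Icc_mem_nhds hσ.1 (hσ.2.trans_le hs.2)))
  -- (ii) Fubini for the derivative integrand on `Ioc 0 s × ℝ^ι`
  obtain ⟨C, -, hC⟩ := exists_norm_coef_clamp_le hT hg hgd l
  have hKr : (Module.finrank ℝ (EuclideanSpace ℝ ι) : ℝ) <
      ((Module.finrank ℝ (EuclideanSpace ℝ ι) + 1 : ℕ) : ℝ) := by push_cast; linarith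
  have hint : Integrable (uncurry fun (σ : ℝ) (x : EuclideanSpace ℝ ι) => 𝐞 ⟪x, ξ⟫ • Ψ σ x)
      ((volume.restrict (Ioc 0 s)).prod volume) := by
    have h1 : Integrable (fun z : ℝ × EuclideanSpace ℝ ι => (1 : ℝ) *
        (C * (1 + ‖z.2‖) ^ (-((Module.finrank ℝ (EuclideanSpace ℝ ι) + 1 : ℕ) : ℝ))))
        ((volume.restrict (Ioc 0 s)).prod volume) :=
      Integrable.mul_prod (f := fun _ : ℝ => (1 : ℝ))
        (integrableOn_const (μ := volume) (s := Ioc (0 : ℝ) s) (C := (1 : ℝ))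
          (hs := measure_Ioc_lt_top.ne))
        ((integrable_one_add_norm hKr).const_mul C)
    refine h1.mono' (continuous_fourierIntegrand_clamp hT hg ξ l).aestronglyMeasurable
      (ae_of_all _ fun z => ?_)
    change ‖𝐞 ⟪z.2, ξ⟫ • Ψ z.1 z.2‖ ≤ _
    rw [Circle.norm_smul, one_mul]
    exact hC z.1 z.2
  have hswap := integral_integral_swap hint
  -- (iii) assemble
  have hΦi : ∀ σ, Integrable fun x : EuclideanSpace ℝ ι => 𝐞 ⟪x, ξ⟫ • Φ σ x := fun σ =>
    integrable_fourierIntegrand_clamp hT hf hd σ ξ l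
  calc ∫ σ in (0 : ℝ)..s, forceData hT hg hgd σ ξ l
      = ∫ σ in Ioc 0 s, ∫ x, 𝐞 ⟪x, ξ⟫ • Ψ σ x := by
        rw [intervalIntegral.integral_of_le hs0]
        exact setIntegral_congr_fun measurableSet_Ioc fun σ _ => hb' σ
    _ = ∫ x, ∫ σ in Ioc 0 s, 𝐞 ⟪x, ξ⟫ • Ψ σ x := hswap
    _ = ∫ x, 𝐞 ⟪x, ξ⟫ • (Φ s x - Φ 0 x) := by
        refine integral_congr_ae (ae_of_all _ fun x => ?_)
        simp only
        rw [← hFTC x, intervalIntegral.integral_of_le hs0]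
        simp_rw [Circle.smul_def, smul_eq_mul]
        exact integral_const_mul _ _
    _ = ∫ x, (𝐞 ⟪x, ξ⟫ • Φ s x - 𝐞 ⟪x, ξ⟫ • Φ 0 x) := by simp_rw [smul_sub]
    _ = (∫ x, 𝐞 ⟪x, ξ⟫ • Φ s x) - ∫ x, 𝐞 ⟪x, ξ⟫ • Φ 0 x := integral_sub (hΦi s) (hΦi 0)
    _ = forceData hT hf hd s ξ l - forceData hT hf hd 0 ξ l := by rw [hb, hb]

/-- **`∂ₜ` of the Fourier-side force is the Fourier-side force of `∂ₜf`, on the closed slab**: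
for every `t ∈ [0, T]`, frequency `ξ` and component `l`,
`HasDerivWithinAt (s ↦ forceData f s ξ l) (forceData (∂ₜf) t ξ l) (Icc 0 T) t`,
`∂ₜf = timeDerivWithin (Icc 0 T) f` (one-sided at the endpoints).
[cite: Tao2011, Thm. 5.4 proof (arXiv Thm. 31, p. 18)] -/
theorem hasDerivWithinAt_forceData {t : ℝ} (ht : t ∈ Icc 0 T) (ξ : EuclideanSpace ℝ ι) (l : ι) :
    HasDerivWithinAt (fun s => forceData hT hf hd s ξ l)
      (forceData hT (hf.timeDerivWithin (uniqueDiffOn_Icc hT))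
        (hd.timeDerivWithin hf (uniqueDiffOn_Icc hT)) t ξ l) (Icc 0 T) t := by
  have hc := continuous_forceData_time_apply hT (hf.timeDerivWithin (uniqueDiffOn_Icc hT))
    (hd.timeDerivWithin hf (uniqueDiffOn_Icc hT)) ξ l
  have h1 := ((hc.integral_hasStrictDerivAt 0 t).hasDerivAt.const_add
    (forceData hT hf hd 0 ξ l)).hasDerivWithinAt (s := Icc 0 T)
  refine h1.congr_of_mem (fun s hs => ?_) ht
  rw [integral_forceData_timeDerivWithin hT hf hd hs]
  ring

end TimeDeriv

/-! ### §3 The derivative tower of the Fourier-side force -/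

section Family

variable {ι : Type*} [Fintype ι]
variable {T : ℝ} {f : ℝ → EuclideanSpace ℝ ι → EuclideanSpace ℝ ι}

/-- `forceData` does not depend on the proofs, and is unchanged under rewriting the force.
[cite: Tao2011, Thm. 5.4 proof (arXiv Thm. 31, p. 18)] -/
theorem forceData_congr (hT : 0 < T) (hf : IsSmoothSpaceTimeOn (Icc 0 T) f)
    (hd : HasUniformRapidDecayOn (Icc 0 T) f) {g : ℝ → EuclideanSpace ℝ ι → EuclideanSpace ℝ ι}
    (hfg : f = g) (hg : IsSmoothSpaceTimeOn (Icc 0 T) g) (hgd : HasUniformRapidDecayOn (Icc 0 T) g) :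
    forceData hT hf hd = forceData hT hg hgd := by
  subst hfg
  rfl

variable (hT : 0 < T) (hf : IsSmoothSpaceTimeOn (Icc 0 T) f) (hd : HasUniformRapidDecayOn (Icc 0 T) f)

/-- **The derivative tower of the Fourier-side force**: `forceDataFamily k` is the Fourier-side
force of the `k`-th slab time derivative `(timeDerivWithin (Icc 0 T))^[k] f` (again Schwartz on the
slab by `HasUniformRapidDecayOn.iterate_timeDerivWithin`), i.e.
`forceDataFamily k t ξ l = 𝓕⁻(((∂ₜᵏ f)(clamp T t))ₗ^ℂ)(ξ)`. [cite: Tao2011, Thm. 5.4 proof (arXiv Thm. 31, p. 18)] -/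
def forceDataFamily (k : ℕ) : ℝ → EuclideanSpace ℝ ι → ι → ℂ :=
  forceData hT (hd.iterate_timeDerivWithin hf (uniqueDiffOn_Icc hT) k).1
    (hd.iterate_timeDerivWithin hf (uniqueDiffOn_Icc hT) k).2

/-- The tower starts at the force: `forceDataFamily 0 = forceData`. [cite: Tao2011, Thm. 5.4 proof (arXiv Thm. 31, p. 18)] -/
theorem forceDataFamily_zero : forceDataFamily hT hf hd 0 = forceData hT hf hd := rfl

/-- The successor member is the Fourier-side force of `∂ₜ` of the previous slab derivative.
[cite: Tao2011, Thm. 5.4 proof (arXiv Thm. 31, p. 18)] -/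
theorem forceDataFamily_succ (k : ℕ) : forceDataFamily hT hf hd (k + 1) =
    forceData hT
      ((hd.iterate_timeDerivWithin hf (uniqueDiffOn_Icc hT) k).1.timeDerivWithin (uniqueDiffOn_Icc hT))
      ((hd.iterate_timeDerivWithin hf (uniqueDiffOn_Icc hT) k).2.timeDerivWithin
        (hd.iterate_timeDerivWithin hf (uniqueDiffOn_Icc hT) k).1 (uniqueDiffOn_Icc hT)) :=
  forceData_congr hT _ _ (Function.iterate_succ_apply' _ k f) _ _

/-- Pointwise form of a tower member on the slab: for `t ∈ [0, T]`,
`forceDataFamily k t ξ l = 𝓕⁻ (((timeDerivWithin (Icc 0 T))^[k] f t)ₗ^ℂ) ξ`.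
[cite: Tao2011, Thm. 5.4 proof (arXiv Thm. 31, p. 18)] -/
theorem forceDataFamily_apply_of_mem (k : ℕ) {t : ℝ} (ht : t ∈ Icc 0 T)
    (ξ : EuclideanSpace ℝ ι) (l : ι) :
    forceDataFamily hT hf hd k t ξ l =
      𝓕⁻ (fun x => ((((FluidPDE.timeDerivWithin (Icc 0 T))^[k] f) t x l : ℝ) : ℂ)) ξ :=
  forceData_apply_of_mem hT _ _ ht ξ l

/-- **Conjugation symmetry** of every tower member (the time derivatives of the force are real).
[cite: Tao2011, Thm. 5.4 proof (arXiv Thm. 31, p. 18)] -/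
theorem forceDataFamily_conj_symm (k : ℕ) (t : ℝ) (ξ : EuclideanSpace ℝ ι) (l : ι) :
    forceDataFamily hT hf hd k t (-ξ) l = conj (forceDataFamily hT hf hd k t ξ l) :=
  forceData_conj_symm hT _ _ t ξ l

/-- **Synthesis of a tower member is the slab time derivative**: for `t ∈ [0, T]`,
`synthVel (forceDataFamily k t) = ((timeDerivWithin (Icc 0 T))^[k] f) t`.
[cite: SteinWeiss1971, Ch. I Thm. 2.3 + Thm. 1.8] -/
theorem synthVel_forceDataFamily_of_mem (k : ℕ) {t : ℝ} (ht : t ∈ Icc 0 T) :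
    synthVel (forceDataFamily hT hf hd k t) = ((FluidPDE.timeDerivWithin (Icc 0 T))^[k] f) t :=
  synthVel_forceData_of_mem hT _ _ ht

/-- **Uniform decay of every order of every tower member**: for all `k, K` one constant `B ≥ 0`
with `HasDecay K B (forceDataFamily k t)` for all `t`. [cite: Tao2011, Thm. 5.4 proof (arXiv Thm. 31, p. 18)] -/
theorem hasDecay_forceDataFamily_uniform (k K : ℕ) :
    ∃ B : ℝ, 0 ≤ B ∧ ∀ t : ℝ, HasDecay K B (forceDataFamily hT hf hd k t) :=
  hasDecay_forceData_uniform hT _ _ K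

/-- **Joint continuity** of every tower member: `(t, ξ) ↦ forceDataFamily k t ξ` is continuous on
`ℝ × ℝ^ι`. [cite: Tao2011, Thm. 5.4 proof (arXiv Thm. 31, p. 18)] -/
theorem continuous_forceDataFamily_uncurry (k : ℕ) :
    Continuous fun p : ℝ × EuclideanSpace ℝ ι => forceDataFamily hT hf hd k p.1 p.2 :=
  continuous_forceData_uncurry hT _ _

/-- Continuity in time at fixed frequency of every tower member. [cite: Tao2011, Thm. 5.4 proof (arXiv Thm. 31, p. 18)] -/
theorem continuous_forceDataFamily_time_apply (k : ℕ) (ξ : EuclideanSpace ℝ ι) (l : ι) :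
    Continuous fun t : ℝ => forceDataFamily hT hf hd k t ξ l :=
  continuous_forceData_time_apply hT _ _ ξ l

/-- **`∂ₜ B_k = B_{k+1}` within `[0, T]`**: for every `t ∈ [0, T]`,
`HasDerivWithinAt (s ↦ forceDataFamily k s ξ l) (forceDataFamily (k+1) t ξ l) (Icc 0 T) t`.
[cite: Tao2011, Thm. 5.4 proof (arXiv Thm. 31, p. 18)] -/
theorem hasDerivWithinAt_forceDataFamily (k : ℕ) {t : ℝ} (ht : t ∈ Icc 0 T)
    (ξ : EuclideanSpace ℝ ι) (l : ι) :
    HasDerivWithinAt (fun s => forceDataFamily hT hf hd k s ξ l)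
      (forceDataFamily hT hf hd (k + 1) t ξ l) (Icc 0 T) t := by
  rw [forceDataFamily_succ]
  exact hasDerivWithinAt_forceData hT _ _ ht ξ l

/-- **Every component of the tower is a Fourier family of every order on `[0, T]`** (measurable
slices, uniform `HasDecay` of every order, continuity in time, `∂ₜ B_k = B_{k+1}` within `[0, T]`)
— the force-side input of `IsSobolevMildForced.exists_family` / `.classical`.
[cite: Tao2011, Thm. 5.4 proof (arXiv Thm. 31, p. 18)] -/
theorem isFourierFamily_forceDataFamily (n : ℕ) (l : ι) :
    IsFourierFamily T n (fun k t ξ => forceDataFamily hT hf hd k t ξ l) where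
  meas k _ t _ :=
    ((continuous_apply l).comp (continuous_forceData_slice hT _ _ t)).aestronglyMeasurable
  decay k _ K := by
    obtain ⟨B, -, hB⟩ := hasDecay_forceDataFamily_uniform hT hf hd k K
    exact ⟨B, fun t _ ξ => (norm_le_pi_norm _ l).trans (hB t ξ)⟩
  cont k _ ξ := (continuous_forceDataFamily_time_apply hT hf hd k ξ l).continuousOn
  deriv k _ ξ t ht := hasDerivWithinAt_forceDataFamily hT hf hd k ht ξ l

/-- Every component of the tower is a square-dominated family of every order on `[0, T]` (the
binder shape of `IsSobolevMildForced.exists_family`). [cite: Tao2011, Thm. 5.4 proof (arXiv Thm. 31, p. 18)] -/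
theorem isDomFamily_forceDataFamily (n : ℕ) (l : ι) :
    IsDomFamily T n (fun k t ξ => forceDataFamily hT hf hd k t ξ l) :=
  (isFourierFamily_forceDataFamily hT hf hd n l).isDomFamily

/-- **The derivative tower of the Fourier-side force, packaged**: there is `B : ℕ → (ℝ → ℝ^ι → ι → ℂ)`
with `B 0 = forceData f`, all components Fourier families of every order on `[0, T]`, every member
conjugation symmetric, and `synthVel (B k t) = (∂ₜᵏ f) t` on `[0, T]`
(`B = forceDataFamily`). [cite: Tao2011, Thm. 5.4 proof (arXiv Thm. 31, p. 18)] -/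
theorem exists_forceData_tower :
    ∃ B : ℕ → ℝ → EuclideanSpace ℝ ι → ι → ℂ, B 0 = forceData hT hf hd ∧
      (∀ n l, IsFourierFamily T n (fun k t ξ => B k t ξ l)) ∧
      (∀ k t ξ l, B k t (-ξ) l = conj (B k t ξ l)) ∧
      (∀ k, ∀ t ∈ Icc 0 T, synthVel (B k t) = ((FluidPDE.timeDerivWithin (Icc 0 T))^[k] f) t) :=
  ⟨forceDataFamily hT hf hd, forceDataFamily_zero hT hf hd, isFourierFamily_forceDataFamily hT hf hd,
    forceDataFamily_conj_symm hT hf hd, fun k _ ht => synthVel_forceDataFamily_of_mem hT hf hd k ht⟩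

end Family

end FourierNS

end Literature.Analysis.FluidPDE

end
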